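import Summits.HodgeConjecture.HodgeConjecture.Theorems.R90S6MacdonaldClosedForm    -- F2′: `macdonaldSum`, `macdonaldSum_succ_succ_sub`, `satakeTransform_…_torusGen_pow_eq`
import HarnessLib

/-!
# R90 · S6 — card F2′ (second half) «INVERSE EXPANSION OF THE ORBIT SUMS»: `h_m = Σ_{k≤m} e_{m−k} 𝒮(φ_k)` with `e_j = Σ_{i≤j} (−√Q)ⁱ`, hence
# `Q^m (x^{ℓ_m} + x^{ℓ_{−m}}) = Σ_{k≤m} (e_{m−k} − Q² e_{m−k−2}) 𝒮(φ_k)` — the `W`-orbit sums `S_m` of the unramified `U(3)` in the Hecke basis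
# `φ_k = 1_{K₀ tᵏ K₀}`, and `S_m` itself in `ℋ` by Satake injectivity (`Theorems/R90S6MacdonaldOrbitSumInversion.lean`)

Cell `hodgecm-mathlib`, crux H413 (`stmt-HodgeConjecture-24833`), route `HCCMUnconditional`; R90-TF section S6 (base `R90-C14`), seat R90-C14-p09 (g0); card F2′
(dealer R90-C14-plan (g2), DAG r5 row E1.3.2.1: «… + the INVERSE EXPANSION of the orbit sums `S_m := 𝒮⁻¹(Q^m(x^{mℓ₁} + x^{mℓ₋₁}))` in the `φ_k`»), sequel of
`Theorems/R90S6MacdonaldClosedForm.lean` (the closed form `𝒮(φ_m) = h_m + (√Q − 1) h_{m−1} − √Q h_{m−2}`).  Lane `--supports stmt-HodgeConjecture-24833 --as helper`;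
THEOREMS ONLY (no definition ∕ instance ∕ notation ∕ named fact ∕ `sorry`); imports = `Theorems.R90S6MacdonaldClosedForm` + HarnessLib.

THE PRINT.  [Macdonald1971, Ch. V §3 (3.4)] ∕ [CartierCorvallis1979, §IV (4.2), Thm. 4.1]: `Σ_m 𝒮(φ_m) Tᵐ = (1 + √Q T)(1 − T) ∕ ((1 − uT)(1 − vT))` with
`u = Q x^{ℓ₁}`, `v = Q x^{ℓ₋₁}`; inverting the numerator, `1 ∕ ((1 + √Q T)(1 − T)) = Σ_j e_j Tʲ`, `e_j = Σ_{i=0}^{j} (−√Q)ⁱ`, gives the complete homogeneous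
sums `h_m = Σ_{k≤m} e_{m−k} 𝒮(φ_k)` and then the power (= `W`-orbit) sums `Q^m(x^{ℓ_m} + x^{ℓ_{−m}}) = h_m − Q² h_{m−2}` in the basis `𝒮(φ_k)`; since `𝒮` is
injective [CartierCorvallis1979, Thm. 4.1], this IS the expansion of `S_m ∈ ℋ(U(3), K₀)` in the `φ_k` — the shape Rogawski uses for `ξ̂_H`, `b` on Hecke
functions [Rogawski1990, §4.5 p. 50].

WHAT IS PROVED (frame of `R90S6MacdonaldClosedForm`: `hd : UnramifiedLocalConjDatum σ ϖ`, `hσ : σ ≠ id`, `[Finite 𝓀[K]]`, the Hecke pair;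
`φ_k = doubleCosetOperator K₀ (hd.torusGen ^ k)`, `Q = #𝓀[K]`, `√Q = Nat.sqrt Q`, `e_j` written inline as `Σ_{i ∈ range (j+1)} (−√Q)ⁱ`):
* §1 pure algebra over any `ℂ`-module: `altGeomSum_succ_succ` (`e_{j+2} = (1 − q) e_{j+1} + q e_j`) and **`eq_sum_altGeomSum_smul_of_closedForm`**
  (`S₀ = h₀`, `S₁ = h₁ + (q−1)h₀`, `S_{n+2} = h_{n+2} + (q−1)h_{n+1} − q h_n` ⇒ `h_m = Σ_{k≤m} e_{m−k} S_k`, two-step induction).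
* §2 on the Satake side: `satakeTransform_doubleCosetOperator_torusGen_pow_zero` (`𝒮(φ₀) = 1 = h₀`), **`macdonaldSum_eq_sum_satakeTransform`**
  (`h_m = Σ_{k≤m} e_{m−k} 𝒮(φ_k)`, all `m`), **`orbitSum_eq_sum_satakeTransform`** (`Q^{n+2}(x^{ℓ_{n+2}} + x^{ℓ_{−(n+2)}}) = Σ_{k≤n+2} e_{n+2−k} 𝒮(φ_k) −
  Q² Σ_{k≤n} e_{n−k} 𝒮(φ_k)`), `orbitSum_one_eq_satakeTransform` (`Q(x^{ℓ₁}+x^{ℓ₋₁}) = 𝒮(φ₁) − (√Q−1)·1`), and the one-sum coefficient form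
  **`orbitSum_succ_eq_sum_smul_satakeTransform`**: `Q^{m+1}(x^{ℓ_{m+1}} + x^{ℓ_{−(m+1)}}) = Σ_{k≤m+1} (e_{m+1−k} − Q² e_{m−1−k}) 𝒮(φ_k)` for ALL `m`
  (`ℕ`-truncated ranges make `e_{<0} = 0`): coefficients `1, 1 − √Q, 1 − √Q + Q − Q², …` of `φ_{m+1}, φ_m, φ_{m−1}, …`.
* §3 back in `ℋ`: **`satakeTransform_orbitSumHecke`** (`𝒮(Σ_{k≤m+1} (e_{m+1−k} − Q² e_{m−1−k}) φ_k) = Q^{m+1}(x^{ℓ_{m+1}} + x^{ℓ_{−(m+1)}})`) and, by ★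
  `satakeTransform_injective`, **`eq_orbitSumHecke_of_satakeTransform_eq`** (any `T` with that Satake transform IS that combination).
TECHNIQUE NOTE: on the heavy carrier `ℋ = ↥(heckeAlgebra ℂ G K₀)` a bare `map_sum`/`map_smul`/`sub_eq_add_neg` rewrite does not elaborate in budget; all
linearity is pushed through the light-carrier helper `algHom_apply_sum_smul` (instances flow from the type of `f`), and `ℋ`-side statements avoid `−` on `ℋ`.
HONEST LABEL: local spherical Hecke-algebra algebra; proves no printed global statement, discharges no citation; count-neutral helper until E1.3.5.2.5 ∕
E1.4.4.2.3 consume it.  HC_CM is proved only modulo the 7 printed citations (2 remaining named inputs: hLiu418 = stmt-HodgeConjecture-24832, h413 =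
stmt-HodgeConjecture-24833) until rung 0 closes; REL ≠ ★ ≠ BUILT.

## Tree search
`macdonaldSum(_zero/_one/_succ_succ_sub)`, `satakeTransform_doubleCosetOperator_torusGen_pow_eq`, `…_torusGen_eq_macdonaldSum`, `single_lineThree_congr`
[Theorems/R90S6MacdonaldClosedForm]; ★ `doubleCosetOperator_one` [HeckeAlgebra]; ★ `UnramifiedLocalConjDatum.satakeTransform_injective`
[HyperspecialUnitarySatakeInjective :234]; Mathlib `Finset.sum_range_succ`, `Finset.sum_sub_distrib`, `Finset.smul_sum`, `sub_smul`, `mul_smul`, `module`.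
Dedup: `rg "altGeomSum|orbitSumHecke|OrbitSumInversion|sum_satakeTransform"` over `lean/` — no hit; N = 2 twin = p03 (g2) ★ `R90S6MacdonaldClosedFormU2`
(`smul_orbitSum_eq_satakeTransform_sub_two`), not restated here.

## References
* [Macdonald1971] I. G. Macdonald, *Spherical functions on a group of p-adic type*, Ramanujan Inst. Publ. 2 (1971), Ch. V §3, (3.4).
* [CartierCorvallis1979] P. Cartier, *Representations of 𝔭-adic groups: a survey*, PSPM 33.1 (1979), §IV (4.2)–(4.4), Thm. 4.1.
* [Rogawski1990] J. D. Rogawski, *Automorphic Representations of Unitary Groups in Three Variables*, Ann. of Math. Stud. 123 (1990), §4.5 p. 50.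
-/

set_option autoImplicit false
-- the mandated namespace repeats the single-problem summit's segment (`HodgeConjecture.HodgeConjecture`)
set_option linter.dupNamespace false

noncomputable section

open scoped Valued WithZero Matrix MatrixGroups Pointwise
open MulAction Finset

namespace Summit.HodgeConjecture.HodgeConjecture.R90.S6

open Literature.NumberTheory.Automorphic Literature.NumberTheory.Automorphic.HermitianLattice
  Literature.NumberTheory.Automorphic.HermitianLattice.UnramifiedLocalConjDatum Literature.NumberTheory.Automorphic.CartanUnique
  Literature.NumberTheory.Automorphic.SymplecticCartan Literature.NumberTheory.Automorphic.heckeAlgebra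

/-! ## §1 Pure algebra: inverting the convolution `S = (1, q−1, −q) ∗ h` by `e_j = Σ_{i≤j} (−q)ⁱ` (`(1 + qT)(1 − T) · Σ e_j Tʲ = 1`) -/

/-- The truncated alternating geometric sums `e_j = Σ_{i=0}^{j} (−q)ⁱ` satisfy `e_{j+2} = (1 − q) e_{j+1} + q e_j`. [folklore] -/
theorem altGeomSum_succ_succ (q : ℂ) (j : ℕ) :
    (∑ i ∈ range (j + 3), (-q) ^ i) = (1 - q) * (∑ i ∈ range (j + 2), (-q) ^ i) + q * ∑ i ∈ range (j + 1), (-q) ^ i := by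
  rw [sum_range_succ, sum_range_succ]
  ring

/-- **THE INVERSE EXPANSION (pure algebra)**: if `S₀ = h₀`, `S₁ = h₁ + (q − 1) h₀` and `S_{n+2} = h_{n+2} + (q − 1) h_{n+1} − q h_n` for all `n`, then
`h_m = Σ_{k=0}^{m} e_{m−k} · S_k` with `e_j = Σ_{i=0}^{j} (−q)ⁱ` — the power-series identity `Σ h_m Tᵐ = (Σ e_j Tʲ)(Σ S_m Tᵐ)`,
`Σ e_j Tʲ = 1 ∕ ((1 + qT)(1 − T))`. [cite: Macdonald1971, Ch. V §3] -/
theorem eq_sum_altGeomSum_smul_of_closedForm {A : Type*} [AddCommGroup A] [Module ℂ A] (q : ℂ) (h S : ℕ → A) (h0 : S 0 = h 0)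
    (h1 : S 1 = h 1 + (q - 1) • h 0) (hrec : ∀ n, S (n + 2) = h (n + 2) + (q - 1) • h (n + 1) - q • h n) (m : ℕ) :
    h m = ∑ k ∈ range (m + 1), (∑ i ∈ range (m - k + 1), (-q) ^ i) • S k := by
  -- two-step induction
  suffices key : ∀ n, h n = ∑ k ∈ range (n + 1), (∑ i ∈ range (n - k + 1), (-q) ^ i) • S k ∧
      h (n + 1) = ∑ k ∈ range (n + 1 + 1), (∑ i ∈ range (n + 1 - k + 1), (-q) ^ i) • S k from (key m).1
  intro n
  induction n with
  | zero =>
    refine ⟨?_, ?_⟩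
    · simp only [zero_add, sum_range_one, Nat.sub_zero, pow_zero, one_smul, h0]
    · simp only [zero_add, sum_range_succ, sum_range_zero, Nat.sub_zero, Nat.sub_self, pow_zero, pow_one, one_smul, h1, h0]
      module
  | succ n ih =>
    obtain ⟨ihA, ihB⟩ := ih
    refine ⟨ihB, ?_⟩
    -- `h_{n+2} = S_{n+2} − (q−1) h_{n+1} + q h_n`, then compare coefficients with the `e`-recurrence
    have hsol : h (n + 1 + 1) = S (n + 1 + 1) - (q - 1) • h (n + 1) + q • h n := by
      have h2 := hrec n
      rw [show n + 2 = n + 1 + 1 from rfl] at h2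
      rw [h2]
      module
    rw [hsol, ihA, ihB, sum_range_succ (n := n + 1 + 1), sum_range_succ (n := n + 1), sum_range_succ (n := n + 1),
      show n + 1 - (n + 1) + 1 = 1 by omega, show n + 1 + 1 - (n + 1 + 1) + 1 = 1 by omega, show n + 1 + 1 - (n + 1) + 1 = 1 + 1 by omega,
      sum_range_one, pow_zero, one_smul, one_smul, sum_range_succ (n := 1), sum_range_one, pow_zero, pow_one, smul_add, Finset.smul_sum,
      Finset.smul_sum]
    -- the bulk `k ≤ n`: `e_{n+2−k} = (1−q) e_{n+1−k} + q e_{n−k}`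
    have hbulk : ∑ k ∈ range (n + 1), (∑ i ∈ range (n + 1 + 1 - k + 1), (-q) ^ i) • S k =
        ∑ k ∈ range (n + 1), (-((q - 1) • ((∑ i ∈ range (n + 1 - k + 1), (-q) ^ i) • S k)) + q • ((∑ i ∈ range (n - k + 1), (-q) ^ i) • S k)) := by
      refine sum_congr rfl fun k hk => ?_
      have hk' : k < n + 1 := mem_range.1 hk
      rw [show n + 1 + 1 - k + 1 = (n - k) + 3 by omega, show n + 1 - k + 1 = (n - k) + 2 by omega, altGeomSum_succ_succ, smul_smul,
        smul_smul, ← neg_smul, ← add_smul]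
      congr 1
      ring
    rw [hbulk, sum_add_distrib, sum_neg_distrib]
    module

variable {K : Type*} [Field K] [Valued K ℤᵐ⁰] {σ : K →+* K} {ϖ : K} [Finite 𝓀[K]]
  [IsHeckeTriple (⊤ : Submonoid (unitaryGroupOfForm σ ((StdForm.antidiagonal 3).over K))) (unitaryInt σ ((StdForm.antidiagonal 3).over K))
    (unitaryInt σ ((StdForm.antidiagonal 3).over K))]

/-! ## §2 The `h_m` and the orbit sums `Q^m (x^{ℓ_m} + x^{ℓ_{−m}})` in the Hecke basis `𝒮(φ_k)` -/

/-- `𝒮(φ₀) = 𝒮(1) = 1 = h_0`. [cite: CartierCorvallis1979, §IV (4.2)] -/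
theorem satakeTransform_doubleCosetOperator_torusGen_pow_zero (hd : UnramifiedLocalConjDatum σ ϖ) :
    hd.satakeTransform (doubleCosetOperator (unitaryInt σ ((StdForm.antidiagonal 3).over K)) (hd.torusGen ^ 0)) =
      macdonaldSum (Nat.card 𝓀[K] : ℂ) 0 := by
  rw [pow_zero, doubleCosetOperator_one, macdonaldSum_zero]
  exact hd.satakeTransform.toRingHom.map_one

/-- **`h_m = Σ_{k=0}^{m} e_{m−k} 𝒮(φ_k)`**, `e_j = Σ_{i=0}^{j} (−√Q)ⁱ`: Macdonald's complete homogeneous sums in the Hecke basis `φ_k = 1_{K₀ tᵏ K₀}` of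
`ℋ(U(σ,J₀)(K), K₀)` (through `𝒮`). [cite: Macdonald1971, Ch. V §3] [cite: CartierCorvallis1979, §IV Thm. 4.1] -/
theorem macdonaldSum_eq_sum_satakeTransform (hd : UnramifiedLocalConjDatum σ ϖ) (hσ : ∃ x : K, σ x ≠ x) (m : ℕ) :
    macdonaldSum (Nat.card 𝓀[K] : ℂ) m =
      ∑ k ∈ range (m + 1), (∑ i ∈ range (m - k + 1), (-(Nat.sqrt (Nat.card 𝓀[K]) : ℂ)) ^ i) •
        hd.satakeTransform (doubleCosetOperator (unitaryInt σ ((StdForm.antidiagonal 3).over K)) (hd.torusGen ^ k)) := by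
  refine eq_sum_altGeomSum_smul_of_closedForm (Nat.sqrt (Nat.card 𝓀[K]) : ℂ) (macdonaldSum (Nat.card 𝓀[K] : ℂ))
    (fun k => hd.satakeTransform (doubleCosetOperator (unitaryInt σ ((StdForm.antidiagonal 3).over K)) (hd.torusGen ^ k))) ?_ ?_ ?_ m
  · exact satakeTransform_doubleCosetOperator_torusGen_pow_zero hd
  · simp only [pow_one]
    exact satakeTransform_doubleCosetOperator_torusGen_eq_macdonaldSum hd hσ
  · intro n
    have h := satakeTransform_doubleCosetOperator_torusGen_pow_eq hd hσ (m := n + 2) (by omega)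
    rw [show n + 2 - 1 = n + 1 by omega, show n + 2 - 2 = n by omega] at h
    exact h

/-- **THE ORBIT SUMS IN THE HECKE BASIS** (`m = n + 2 ≥ 2`): `Q^{n+2} (x^{ℓ_{n+2}} + x^{ℓ_{−(n+2)}}) = Σ_{k≤n+2} e_{n+2−k} 𝒮(φ_k) − Q² Σ_{k≤n} e_{n−k} 𝒮(φ_k)`,
`e_j = Σ_{i≤j} (−√Q)ⁱ` — i.e. (by ★ `satakeTransform_injective`) the `W`-orbit sum `S_m := 𝒮⁻¹(Q^m(x^{ℓ_m} + x^{ℓ_{−m}}))` is the explicit combination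
`φ_m + (1 − √Q) φ_{m−1} + (1 − √Q + Q − Q²) φ_{m−2} + ⋯` of the `φ_k`; the expansion E1.3.2.1 names for `ξ̂_H(φ_m)`, `b(φ_λ)` (E1.3.5.2.5, E1.4.4.2.3).
[cite: Macdonald1971, Ch. V §3] [cite: CartierCorvallis1979, §IV Thm. 4.1] [cite: Rogawski1990, §4.5 p. 50] -/
theorem orbitSum_eq_sum_satakeTransform (hd : UnramifiedLocalConjDatum σ ϖ) (hσ : ∃ x : K, σ x ≠ x) (n : ℕ) :
    ((Nat.card 𝓀[K] : ℂ) ^ (n + 2)) • (AddMonoidAlgebra.single (fun t : Fin 3 => ((n : ℤ) + 2) * (1 - (t : ℕ))) (1 : ℂ) +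
        AddMonoidAlgebra.single (fun t : Fin 3 => (-((n : ℤ) + 2)) * (1 - (t : ℕ))) 1) =
      (∑ k ∈ range (n + 3), (∑ i ∈ range (n + 2 - k + 1), (-(Nat.sqrt (Nat.card 𝓀[K]) : ℂ)) ^ i) •
          hd.satakeTransform (doubleCosetOperator (unitaryInt σ ((StdForm.antidiagonal 3).over K)) (hd.torusGen ^ k))) -
        ((Nat.card 𝓀[K] : ℂ) ^ 2) • ∑ k ∈ range (n + 1), (∑ i ∈ range (n - k + 1), (-(Nat.sqrt (Nat.card 𝓀[K]) : ℂ)) ^ i) •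
          hd.satakeTransform (doubleCosetOperator (unitaryInt σ ((StdForm.antidiagonal 3).over K)) (hd.torusGen ^ k)) := by
  rw [← macdonaldSum_succ_succ_sub, macdonaldSum_eq_sum_satakeTransform hd hσ (n + 2), macdonaldSum_eq_sum_satakeTransform hd hσ n]

/-- The orbit sum at `m = 1`: `Q (x^{ℓ₁} + x^{ℓ₋₁}) = 𝒮(φ₁) − (√Q − 1)·1`. [cite: CartierCorvallis1979, §IV (4.2)] -/
theorem orbitSum_one_eq_satakeTransform (hd : UnramifiedLocalConjDatum σ ϖ) (hσ : ∃ x : K, σ x ≠ x) :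
    (Nat.card 𝓀[K] : ℂ) • (AddMonoidAlgebra.single (fun t : Fin 3 => (1 : ℤ) * (1 - (t : ℕ))) (1 : ℂ) +
        AddMonoidAlgebra.single (fun t : Fin 3 => (-1 : ℤ) * (1 - (t : ℕ))) 1) =
      hd.satakeTransform (doubleCosetOperator (unitaryInt σ ((StdForm.antidiagonal 3).over K)) hd.torusGen) -
        ((Nat.sqrt (Nat.card 𝓀[K]) : ℂ) - 1) • 1 := by
  rw [satakeTransform_doubleCosetOperator_torusGen_eq_macdonaldSum hd hσ, macdonaldSum_one, macdonaldSum_zero, add_sub_cancel_right]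

/-- **THE ORBIT SUMS IN THE HECKE BASIS, ONE SUM WITH EXPLICIT COEFFICIENTS** (all `m + 1 ≥ 1`):
`Q^{m+1} (x^{ℓ_{m+1}} + x^{ℓ_{−(m+1)}}) = Σ_{k=0}^{m+1} (e_{m+1−k} − Q² e_{m−1−k}) · 𝒮(φ_k)` with `e_j = Σ_{i=0}^{j} (−√Q)ⁱ` (`e_j = 0` for `j < 0`,
here by `ℕ`-truncated ranges): the coefficient of `φ_{m+1}` is `1`, of `φ_m` is `1 − √Q`, of `φ_{m−1}` is `1 − √Q + Q − Q²`, ….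
[cite: Macdonald1971, Ch. V §3] [cite: CartierCorvallis1979, §IV Thm. 4.1] -/
theorem orbitSum_succ_eq_sum_smul_satakeTransform (hd : UnramifiedLocalConjDatum σ ϖ) (hσ : ∃ x : K, σ x ≠ x) (m : ℕ) :
    ((Nat.card 𝓀[K] : ℂ) ^ (m + 1)) • (AddMonoidAlgebra.single (fun t : Fin 3 => ((m : ℤ) + 1) * (1 - (t : ℕ))) (1 : ℂ) +
        AddMonoidAlgebra.single (fun t : Fin 3 => (-((m : ℤ) + 1)) * (1 - (t : ℕ))) 1) =
      ∑ k ∈ range (m + 2), ((∑ i ∈ range (m + 2 - k), (-(Nat.sqrt (Nat.card 𝓀[K]) : ℂ)) ^ i) -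
          (Nat.card 𝓀[K] : ℂ) ^ 2 * ∑ i ∈ range (m - k), (-(Nat.sqrt (Nat.card 𝓀[K]) : ℂ)) ^ i) •
        hd.satakeTransform (doubleCosetOperator (unitaryInt σ ((StdForm.antidiagonal 3).over K)) (hd.torusGen ^ k)) := by
  cases m with
  | zero =>
    -- `m + 1 = 1`: `Q p₁ = 𝒮(φ₁) − (√Q − 1)·𝒮(φ₀)`
    simp only [Nat.cast_zero, zero_add, pow_one]
    rw [orbitSum_one_eq_satakeTransform hd hσ, sum_range_succ, sum_range_succ, sum_range_zero, zero_add,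
      satakeTransform_doubleCosetOperator_torusGen_pow_zero hd, macdonaldSum_zero, pow_one]
    simp only [Nat.sub_zero, Nat.sub_self, Nat.zero_sub, sum_range_succ, sum_range_zero, zero_add, pow_zero, pow_one, mul_zero, sub_zero,
      one_smul]
    module
  | succ n =>
    -- `m + 1 = n + 2`: the two-sum form `h_{n+2} − Q² h_n`, re-indexed
    rw [single_lineThree_congr (show ((n + 1 : ℕ) : ℤ) + 1 = (n : ℤ) + 2 by push_cast; ring),
      single_lineThree_congr (show -(((n + 1 : ℕ) : ℤ) + 1) = -((n : ℤ) + 2) by push_cast; ring), show n + 1 + 1 = n + 2 from rfl,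
      orbitSum_eq_sum_satakeTransform hd hσ n, show n + 1 + 2 = n + 1 + 1 + 1 from rfl]
    simp only [sub_smul, sum_sub_distrib, mul_smul, ← smul_sum]
    -- (`congr` would try `rfl` on the big sums and time out; build the congruence by hand)
    refine congrArg₂ HSub.hSub (sum_congr rfl fun k hk => ?_) (congrArg _ ?_)
    · rw [show n + 1 + 1 + 1 - k = n + 2 - k + 1 by have := mem_range.1 hk; omega]
    · rw [sum_range_succ (n := n + 1 + 1), sum_range_succ (n := n + 1), show n + 1 - (n + 1 + 1) = 0 by omega, Nat.sub_self,
        sum_range_zero, zero_smul, zero_smul, add_zero, add_zero]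
      refine sum_congr rfl fun k hk => ?_
      rw [show n + 1 - k = n - k + 1 by have := mem_range.1 hk; omega]

/-! ## §3 Back in `ℋ(U(σ,J₀)(K), K₀)`: the orbit-sum elements `S_m = 𝒮⁻¹(Q^m (x^{ℓ_m} + x^{ℓ_{−m}}))` in the basis `φ_k` -/

/-- An algebra map pushed through `Σ_s a_k • x_k` (light-carrier form: every instance flows from the type of `f`, so that `rw` finds it on the
heavy carrier `ℋ(U(σ,J₀)(K), K₀)`, where a bare `map_sum`/`map_smul` instance search times out). [folklore] -/
theorem algHom_apply_sum_smul {R A B : Type*} [CommSemiring R] [Semiring A] [Semiring B] [Algebra R A] [Algebra R B]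
    (f : A →ₐ[R] B) (s : Finset ℕ) (a : ℕ → R) (x : ℕ → A) : f (∑ k ∈ s, a k • x k) = ∑ k ∈ s, a k • f (x k) := by
  simp only [map_sum, map_smul]

/-- **`S_{m+1}` IN THE HECKE BASIS**: the element `Σ_{k=0}^{m+1} (e_{m+1−k} − Q² e_{m−1−k}) φ_k` of `ℋ(U(σ,J₀)(K), K₀)` (`φ_k = 1_{K₀ tᵏ K₀}`,
`e_j = Σ_{i≤j} (−√Q)ⁱ`) has Satake transform the `W`-orbit sum `Q^{m+1} (x^{ℓ_{m+1}} + x^{ℓ_{−(m+1)}})` — the expansion row E1.3.2.1 names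
for `ξ̂_H(φ_m)` ∕ `b(φ_λ)` (E1.3.5.2.5, E1.4.4.2.3). [cite: Macdonald1971, Ch. V §3] [cite: CartierCorvallis1979, §IV Thm. 4.1] [cite: Rogawski1990, §4.5 p. 50] -/
theorem satakeTransform_orbitSumHecke (hd : UnramifiedLocalConjDatum σ ϖ) (hσ : ∃ x : K, σ x ≠ x) (m : ℕ) :
    hd.satakeTransform (∑ k ∈ range (m + 2), ((∑ i ∈ range (m + 2 - k), (-(Nat.sqrt (Nat.card 𝓀[K]) : ℂ)) ^ i) -
          (Nat.card 𝓀[K] : ℂ) ^ 2 * ∑ i ∈ range (m - k), (-(Nat.sqrt (Nat.card 𝓀[K]) : ℂ)) ^ i) •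
        doubleCosetOperator (unitaryInt σ ((StdForm.antidiagonal 3).over K)) (hd.torusGen ^ k)) =
      ((Nat.card 𝓀[K] : ℂ) ^ (m + 1)) • (AddMonoidAlgebra.single (fun t : Fin 3 => ((m : ℤ) + 1) * (1 - (t : ℕ))) (1 : ℂ) +
        AddMonoidAlgebra.single (fun t : Fin 3 => (-((m : ℤ) + 1)) * (1 - (t : ℕ))) 1) := by
  rw [algHom_apply_sum_smul, orbitSum_succ_eq_sum_smul_satakeTransform hd hσ m]

/-- **UNIQUENESS**: by ★ `satakeTransform_injective`, `S_{m+1} := 𝒮⁻¹(Q^{m+1}(x^{ℓ_{m+1}} + x^{ℓ_{−(m+1)}}))` IS that combination — any `T ∈ ℋ`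
whose Satake transform is the orbit sum equals `Σ_{k=0}^{m+1} (e_{m+1−k} − Q² e_{m−1−k}) φ_k`. [cite: CartierCorvallis1979, §IV Thm. 4.1] -/
theorem eq_orbitSumHecke_of_satakeTransform_eq (hd : UnramifiedLocalConjDatum σ ϖ) (hσ : ∃ x : K, σ x ≠ x) (m : ℕ)
    {T : heckeAlgebra ℂ (unitaryGroupOfForm σ ((StdForm.antidiagonal 3).over K)) (unitaryInt σ ((StdForm.antidiagonal 3).over K))}
    (hT : hd.satakeTransform T =
      ((Nat.card 𝓀[K] : ℂ) ^ (m + 1)) • (AddMonoidAlgebra.single (fun t : Fin 3 => ((m : ℤ) + 1) * (1 - (t : ℕ))) (1 : ℂ) +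
        AddMonoidAlgebra.single (fun t : Fin 3 => (-((m : ℤ) + 1)) * (1 - (t : ℕ))) 1)) :
    T = ∑ k ∈ range (m + 2), ((∑ i ∈ range (m + 2 - k), (-(Nat.sqrt (Nat.card 𝓀[K]) : ℂ)) ^ i) -
          (Nat.card 𝓀[K] : ℂ) ^ 2 * ∑ i ∈ range (m - k), (-(Nat.sqrt (Nat.card 𝓀[K]) : ℂ)) ^ i) •
        doubleCosetOperator (unitaryInt σ ((StdForm.antidiagonal 3).over K)) (hd.torusGen ^ k) :=
  hd.satakeTransform_injective (hT.trans (satakeTransform_orbitSumHecke hd hσ m).symm)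

end Summit.HodgeConjecture.HodgeConjecture.R90.S6

end
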